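import Mathlib

/-!
# LINE `valuative_door` (crux `WeakLifting`, stmt-ValiantsHypothesis-19561) — the support stub `TwoAdicOnReals`
# of `Cruxes/WeakLifting/Lines/valuative_door.lean` (rev 2 @84c5f76c6d22), PROVED: a non-archimedean absolute value on `ℝ` with `|2| < 1`

HONEST FRAMING.  Helper (cell `pub-symmetroid`, seat val-sym-lift-p1 g21, 2026-08-29; `--supports 19561 --as helper`).  The line's stub
`stub_twoAdicOnReals` («formalisation debt, folklore; NOT in Mathlib as stated») asks for `∃ w : AbsoluteValue ℝ ℝ, IsNonarchimedean w ∧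
w 2 < 1`.  Route taken (the docstring's second suggestion, `ℂ ≅ ℂ₂` as abstract fields — here with the ALGEBRAIC CLOSURE `ℚ̄₂ =
PadicAlgCl 2` and its spectral norm, which Mathlib has): (1) `#ℚ₂ = 𝔠` (`mk_padic_two`: at most `𝔠` as a quotient of Cauchy sequences of
rationals; at least `𝔠` because a nonempty perfect complete metric space contains a Cantor set, `Perfect.exists_nat_bool_injection`);
(2) `#ℚ̄₂ = 𝔠` (`Algebra.IsAlgebraic.cardinalMk_le_max`); (3) Steinitz: two uncountable algebraically closed fields of characteristic `0`
and equal cardinality are isomorphic (`IsAlgClosed.ringEquiv_of_equiv_of_charZero`), so `σ : ℂ ≃+* ℚ̄₂`; (4) `w x := ‖σ x‖` for real `x`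
is an absolute value on `ℝ`, non-archimedean (`PadicAlgCl.isNonarchimedean`), with `w 2 = ‖2‖ = 1/2` (`PadicAlgCl.valuation_p`).  Uses
choice (Steinitz), as every such `w` must.  The statement is the skeleton's `TwoAdicOnReals` verbatim (no line-local defs), so
`stub_twoAdicOnReals` becomes an `exact`.  Support stub only — NOT the crux, closes nothing on the ledger by itself, no bearing on vW / vB /
`ValRankOneLaw`, `TropicalB`, `MatrixDescartes` (18050) or VP ≠ VNP.  [folklore: Ostrowski–Steinitz transport; elementary given Mathlib]
-/

set_option linter.dupNamespace false
set_option autoImplicit false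

namespace Summit.ValiantsHypothesis.ValiantsHypothesis.Theorems.KPlusLogSqLaw.ValDoor

open Cardinal

/-- **the field `ℚ₂` of 2-adic numbers has the cardinality of the continuum** (quotient of Cauchy sequences of rationals ⇒ `≤ 𝔠`;
nonempty perfect complete metric space ⇒ contains a Cantor set ⇒ `≥ 𝔠`). [folklore] -/
theorem mk_padic_two : #ℚ_[2] = 𝔠 := by
  haveI : Fact (Nat.Prime 2) := ⟨Nat.prime_two⟩
  apply le_antisymm
  · -- quotient of Cauchy sequences of rationals
    have h1 : #ℚ_[2] ≤ #(PadicSeq 2) := by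
      refine Cardinal.mk_le_of_surjective (f := (Padic.mk : PadicSeq 2 → ℚ_[2])) ?_
      intro x
      exact Quotient.exists_rep x
    have h2 : #(PadicSeq 2) ≤ #(ℕ → ℚ) :=
      Cardinal.mk_le_of_injective (f := fun s : PadicSeq 2 => (s : ℕ → ℚ)) Subtype.val_injective
    have h3 : #(ℕ → ℚ) = 𝔠 := by
      rw [Cardinal.mk_arrow, Cardinal.mk_eq_aleph0 ℚ, Cardinal.mk_eq_aleph0 ℕ]
      simp [Cardinal.aleph0_power_aleph0]
    exact h1.trans (h2.trans h3.le)
  · -- a perfect complete metric space contains a Cantor set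
    haveI : PerfectSpace ℚ_[2] := perfectSpace_iff_forall_not_isolated.2 fun x => inferInstance
    obtain ⟨f, -, -, hf⟩ := Perfect.exists_nat_bool_injection (PerfectSpace.univ_perfect (α := ℚ_[2]))
      Set.univ_nonempty
    have h := Cardinal.mk_le_of_injective hf
    have h4 : #(ℕ → Bool) = 𝔠 := by
      rw [Cardinal.mk_arrow, Cardinal.mk_bool, Cardinal.mk_eq_aleph0 ℕ]
      simp [Cardinal.two_power_aleph0]
    rwa [h4] at h

/-- **the algebraic closure `ℚ̄₂` has the cardinality of the continuum** (algebraic over `ℚ₂`). [folklore] -/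
theorem mk_padicAlgCl_two : #(PadicAlgCl 2) = 𝔠 := by
  haveI : Fact (Nat.Prime 2) := ⟨Nat.prime_two⟩
  apply le_antisymm
  · have h := Algebra.IsAlgebraic.cardinalMk_le_max ℚ_[2] (PadicAlgCl 2)
    rw [mk_padic_two, max_eq_left (Cardinal.aleph0_le_continuum)] at h
    exact h
  · rw [← mk_padic_two]
    exact Cardinal.mk_le_of_injective (algebraMap ℚ_[2] (PadicAlgCl 2)).injective

/-- **`TwoAdicOnReals` (the skeleton's statement, verbatim):** there is a non-archimedean absolute value on `ℝ` with `|2| < 1` — the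
spectral norm of `ℚ̄₂` transported along a field isomorphism `σ : ℂ ≃+* ℚ̄₂` (Steinitz: both are algebraically closed of characteristic
`0` and cardinality `𝔠`) and restricted to `ℝ ⊂ ℂ`; `w 2 = |2|₂ = 1/2`. [folklore; uses choice] -/
theorem twoAdicOnReals_unfolded : ∃ w : AbsoluteValue ℝ ℝ, IsNonarchimedean w ∧ w 2 < 1 := by
  haveI : Fact (Nat.Prime 2) := ⟨Nat.prime_two⟩
  haveI : CharZero (PadicAlgCl 2) :=
    charZero_of_injective_algebraMap (algebraMap ℚ_[2] (PadicAlgCl 2)).injective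
  have hC : ℵ₀ < #ℂ := by rw [Cardinal.mk_complex]; exact Cardinal.aleph0_lt_continuum
  have hCK : Nonempty (ℂ ≃ PadicAlgCl 2) := Cardinal.eq.1 (by rw [Cardinal.mk_complex, mk_padicAlgCl_two])
  obtain ⟨σ⟩ := IsAlgClosed.ringEquiv_of_equiv_of_charZero hC hCK
  refine ⟨{ toFun := fun x => ‖σ (x : ℂ)‖
            map_mul' := fun x y => by simp only [Complex.ofReal_mul, map_mul, norm_mul]
            nonneg' := fun x => norm_nonneg _
            eq_zero' := fun x => by simp
            add_le' := fun x y => by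
              simp only [Complex.ofReal_add, map_add]
              exact norm_add_le _ _ }, ?_, ?_⟩
  · intro x y
    show ‖σ ((x + y : ℝ) : ℂ)‖ ≤ max ‖σ (x : ℂ)‖ ‖σ (y : ℂ)‖
    rw [Complex.ofReal_add, map_add]
    exact PadicAlgCl.isNonarchimedean 2 _ _
  · show ‖σ ((2 : ℝ) : ℂ)‖ < 1
    have h2 : σ ((2 : ℝ) : ℂ) = ((2 : ℕ) : PadicAlgCl 2) := by
      rw [Complex.ofReal_ofNat, map_ofNat, Nat.cast_ofNat]
    rw [h2, ← PadicAlgCl.valuation_coe, PadicAlgCl.valuation_p 2]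
    rw [one_div, NNReal.coe_inv, NNReal.coe_natCast]
    norm_num

end Summit.ValiantsHypothesis.ValiantsHypothesis.Theorems.KPlusLogSqLaw.ValDoor
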